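import Literature.Probability.RandomPlanarGeometry.KSRectangleExit

/-!
# Crossing events are determined by the stopped curve

Helper file for route CardyAnchoredRigidity, item stmt-CriticalPhenomena-14488
(`StretchedPullbackNotTargetBlind`).

For closed sets `A, B, F` with `B ⊆ F ⊆ A ∪ B`, the crossing event "the curve hits `A` before `B`"
(`CurveClass.hitsBefore A B`) is an event of the curve stopped at its first hitting of `F`:
`CurveClass.stopAt F ⁻¹' hitsBefore A B = hitsBefore A B`. This is what makes Cardy-type crossing
events admissible test events in the splitting form of locality (`ChordalFamily.IsTargetIndependent`),
which compares the laws of curves stopped on a boundary arc.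

On the way: an intrinsic description of `hitsBefore A B` for closed `B` — a class hits `A` before
`B` iff its initial segment up to the first hitting of `B` passes through a point of `A ∖ B`
(`CurveClass.mem_hitsBefore_iff`); in particular membership does not depend on the representative.
Elementary; no named facts (`CurveClass.stopAt_mk_holds` is a theorem of the tree).
-/

noncomputable section

open Set Topology
open scoped unitInterval

namespace Summit.CriticalPhenomena.CardyFormulaZ2.Theorems.StretchedPullback

open Literature.Probability.RandomPlanarGeometry

variable {E : Type*}

/-! ### Curve level -/

section CurveLevel

variable [TopologicalSpace E]

/-- If the first hitting parameter of a closed set is `< 1`, the curve is in the set there. -/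
theorem Curve.apply_hitParam_mem_of_lt_one {F : Set E} (hF : IsClosed F) {γ : Curve E}
    (h : γ.hitParam F < 1) : γ ⟨γ.hitParam F, γ.hitParam_mem_Icc F⟩ ∈ F := by
  rcases Curve.hitParam_mem_hitSet hF γ with ⟨hI, hmem⟩ | h1
  · exact hmem
  · exact absurd (mem_singleton_iff.1 h1) h.ne

/-- **A curve hits `A` before the closed set `B` iff its initial segment up to the first hitting of
`B` passes through a point of `A ∖ B`.** -/
theorem Curve.hitsBefore_iff_range_stopAt {A B : Set E} (hB : IsClosed B) (γ : Curve E) :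
    (∃ t : I, γ t ∈ A ∧ ∀ s ≤ t, γ s ∉ B) ↔ ((γ.stopAt B).range ∩ (A \ B)).Nonempty := by
  constructor
  · rintro ⟨t, htA, htB⟩
    have hle : (t : ℝ) ≤ γ.hitParam B := by
      by_contra h
      push Not at h
      have hlt1 : γ.hitParam B < 1 := h.trans_le t.2.2
      have hmem := Curve.apply_hitParam_mem_of_lt_one hB hlt1
      exact htB ⟨γ.hitParam B, γ.hitParam_mem_Icc B⟩ (Subtype.coe_le_coe.1 h.le) hmem
    exact ⟨γ t, Curve.apply_mem_range_stopAt hle, htA, htB t le_rfl⟩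
  · rintro ⟨z, hz, hzA, hzB⟩
    obtain ⟨t, ht, rfl⟩ := Curve.exists_le_hitParam_of_mem_range_stopAt hz
    refine ⟨t, hzA, fun s hs hsB => ?_⟩
    rcases (Subtype.coe_le_coe.2 hs).lt_or_eq with hlt | heq
    · exact Curve.notMem_of_lt_hitParam (hlt.trans_le ht) hsB
    · have : s = t := Subtype.ext heq
      rw [this] at hsB
      exact hzB hsB

/-- If `B ⊆ F ⊆ A ∪ B` (`F` closed), the initial segment up to `F` passes through `A ∖ B` iff
the (longer) initial segment up to `B` does. -/
theorem Curve.range_stopAt_inter_nonempty_iff {A B F : Set E} (hF : IsClosed F)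
    (hBF : B ⊆ F) (hFAB : F ⊆ A ∪ B) (γ : Curve E) :
    ((γ.stopAt F).range ∩ (A \ B)).Nonempty ↔ ((γ.stopAt B).range ∩ (A \ B)).Nonempty := by
  constructor
  · rintro ⟨z, hz, hzAB⟩
    exact ⟨z, Curve.range_stopAt_mono hBF γ hz, hzAB⟩
  · rintro ⟨z, hz, hzA, hzB⟩
    obtain ⟨t, ht, rfl⟩ := Curve.exists_le_hitParam_of_mem_range_stopAt hz
    by_cases htF : (t : ℝ) ≤ γ.hitParam F
    · exact ⟨γ t, Curve.apply_mem_range_stopAt htF, hzA, hzB⟩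
    · push Not at htF
      -- the curve meets `F` strictly before `t`, at a point of `A ∖ B`
      have hlt1 : γ.hitParam F < 1 := htF.trans_le t.2.2
      have hmemF := Curve.apply_hitParam_mem_of_lt_one hF hlt1
      refine ⟨γ ⟨γ.hitParam F, γ.hitParam_mem_Icc F⟩, Curve.apply_mem_range_stopAt le_rfl, ?_, ?_⟩
      · rcases hFAB hmemF with h | h
        · exact h
        · exact absurd (Curve.hitParam_le h) (not_le.2 (htF.trans_le ht))
      · intro h
        exact absurd (Curve.hitParam_le h) (not_le.2 (htF.trans_le ht))

/-- Stopping at a closed set `F` and then at a subset `B ⊆ F` is stopping at `F`: the initial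
segment up to `F` meets `B` at its endpoint at the latest. -/
theorem Curve.stopAt_stopAt_of_subset {B F : Set E} (hBF : B ⊆ F) (γ : Curve E) :
    (γ.stopAt F).stopAt B = γ.stopAt F := by
  rcases eq_or_lt_of_le (γ.hitParam_mem_Icc F).1 with h0 | hpos
  · -- degenerate case: the curve starts on `F`, both curves are constant
    refine Curve.ext (ContinuousMap.ext fun s => ?_)
    show ((γ.stopAt F).stopAt B) s = (γ.stopAt F) s
    rw [Curve.stopAt_apply, Curve.stopAt_apply, Curve.stopAt_apply, ← h0, zero_mul, zero_mul]
  · apply Curve.stopAt_eq_self_of_hitParam_eq_one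
    refine le_antisymm ((γ.stopAt F).hitParam_mem_Icc B).2 (le_csInf ⟨1, Curve.one_mem_hitSet _ _⟩ ?_)
    rintro s (⟨hs, hmem⟩ | hs)
    · rw [Curve.stopAt_apply] at hmem
      have hle := Curve.hitParam_le (hBF hmem)
      have hTs : γ.hitParam F * s ∈ Icc (0 : ℝ) 1 :=
        ⟨mul_nonneg hpos.le hs.1, (mul_le_of_le_one_right hpos.le hs.2).trans (γ.hitParam_mem_Icc F).2⟩
      rw [projIcc_of_mem _ hTs] at hle
      -- `hle : hitParam F ≤ hitParam F * s`
      by_contra h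
      push Not at h
      have : γ.hitParam F * s < γ.hitParam F * 1 := mul_lt_mul_of_pos_left h hpos
      rw [mul_one] at this
      exact absurd hle (not_le.2 this)
    · rw [mem_singleton_iff.1 hs]

end CurveLevel

/-! ### Curve classes -/

section ClassLevel

variable [MetricSpace E]

/-- **Intrinsic description of the crossing event.** For closed `B`, a curve class hits `A` before
`B` iff its initial segment up to the first hitting of `B` passes through a point of `A ∖ B`. -/
theorem CurveClass.mem_hitsBefore_iff {A B : Set E} (hB : IsClosed B) (c : CurveClass E) :
    c ∈ CurveClass.hitsBefore A B ↔ ((c.stopAt B).range ∩ (A \ B)).Nonempty := by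
  constructor
  · rintro ⟨γ, hγ, rfl⟩
    rw [CurveClass.stopAt_mk_holds B hB γ, CurveClass.range_mk]
    exact (Curve.hitsBefore_iff_range_stopAt hB γ).1 hγ
  · intro h
    obtain ⟨γ, rfl⟩ := CurveClass.surjective_mk c
    rw [CurveClass.stopAt_mk_holds B hB γ, CurveClass.range_mk] at h
    exact ⟨γ, (Curve.hitsBefore_iff_range_stopAt hB γ).2 h, rfl⟩

/-- **Crossing events are events of the stopped curve.** For closed `A`-free data `B ⊆ F ⊆ A ∪ B`
(`B`, `F` closed), the class stopped at its first hitting of `F` hits `A` before `B` iff the class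
does: `stopAt F ⁻¹' hitsBefore A B = hitsBefore A B`. -/
theorem CurveClass.stopAt_preimage_hitsBefore {A B F : Set E} (hB : IsClosed B) (hF : IsClosed F)
    (hBF : B ⊆ F) (hFAB : F ⊆ A ∪ B) :
    CurveClass.stopAt F ⁻¹' CurveClass.hitsBefore A B = CurveClass.hitsBefore A B := by
  ext c
  obtain ⟨γ, rfl⟩ := CurveClass.surjective_mk c
  rw [mem_preimage, CurveClass.mem_hitsBefore_iff hB, CurveClass.mem_hitsBefore_iff hB,
    CurveClass.stopAt_mk_holds F hF γ, CurveClass.stopAt_mk_holds B hB,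
    CurveClass.stopAt_mk_holds B hB, CurveClass.range_mk, CurveClass.range_mk,
    Curve.stopAt_stopAt_of_subset hBF, Curve.range_stopAt_inter_nonempty_iff hF hBF hFAB]

end ClassLevel

end Summit.CriticalPhenomena.CardyFormulaZ2.Theorems.StretchedPullback
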